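import Summits.AtomisticToContinuum.HydrodynamicLimit.Theorems.BoltzmannGreenKubo.Negative.QuadraticMazur
import Literature.Analysis.FluidPDE.HardSphereAlexander
import Literature.Analysis.UnboundedOperators.LinearizedBoltzmannProofs

/-!
# `BoltzmannGreenKubo` with `N₀` chosen BEFORE the window `s` is FALSE — the quadratic Mazur floor

Negative knowledge for the crux `AntiMazurCoboundaries.BoltzmannGreenKubo` (stmt-AtomisticToContinuum-13985), from the
standing disprover's `Cruxes/BoltzmannGreenKubo/Disproof.lean` §2d (gen 2): `BoltzmannGreenKuboN0BeforeS` is the crux VERBATIM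
except that `∃ N₀` is moved forward, immediately after `∃ s₀` (the particle-number threshold may depend on everything but the
window `s` and `σ`). It is FALSE (`not_boltzmannGreenKuboN0BeforeS`): by the kernel-checked QUADRATIC MAZUR FLOOR
(`Negative/QuadraticMazur`: Cauchy–Schwarz against the conserved charge `P₀P₁`, which `g_B ⊥ span(1,v,|v|²)` does NOT project
out) the kinetic-window functional per particle at `N = N₀` is `≥ m_B²/(N₀+1) > 0` for every window and every `σ ≤ 1/2`, so
`s·(it) ≤ 2D + 1` fails for `s` large. Hence `N₀ = N₀(s) → ∞` NECESSARILY, at least linearly in `s`: the hidden NONLINEAR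
conserved charges carry Drude weight `Θ(1/N)` per particle (this mechanises the readback's `O(1/N)` remark and sharpens
`Negative/ForallN`, which only removed `N₀` altogether via the collisionless `N = 0`).
refuter-cdisprove-stmt-AtomisticToContinuum-13985-g2-0.
-/

noncomputable section

namespace Summit.AtomisticToContinuum.HydrodynamicLimit.Theorems

open MeasureTheory ProbabilityTheory Filter Topology Set
open Literature.Analysis.FluidPDE Literature.MathematicalPhysics.KineticTheory
open Literature.Analysis.UnboundedOperators
open scoped InnerProductSpace
open BoltzmannGreenKuboForallN BoltzmannGreenKuboOrthMomentum BoltzmannGreenKuboQuadraticMazur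

/-! ### The strengthening "`N₀` chosen before `s`" and its refutation -/

/-- `BoltzmannGreenKubo` with `∃ N₀` moved FORWARD, immediately after `∃ s₀` (so the particle-number threshold may depend on
`(a, θ, u₀, φ, g, η)` but neither on the window `s` nor on `σ`); all else verbatim. -/
def BoltzmannGreenKuboN0BeforeS : Prop :=
  ∀ (a θ : ℝ) (u₀ : Literature.MathematicalPhysics.KineticTheory.V3), 0 < a → 0 < θ → ∀ (φ : Literature.MathematicalPhysics.KineticTheory.T3 → ℝ) (g : Literature.MathematicalPhysics.KineticTheory.V3 → ℝ), Continuous φ → Continuous g → (∀ x, |φ x| ≤ 1) → (∃ K : ℝ, ∀ v, |g v| ≤ K) → (∀ (c₀ c₂ : ℝ) (b : Literature.MathematicalPhysics.KineticTheory.V3), ∫ v, g v * (c₀ + inner ℝ b v + c₂ * ‖v‖ ^ 2) ∂(ProbabilityTheory.stdGaussian Literature.MathematicalPhysics.KineticTheory.V3) = 0) → ∀ η : ℝ, 0 < η → ∃ s₀ : ℝ, 0 < s₀ ∧ ∃ N₀ : ℕ, ∀ s : ℝ, s₀ ≤ s → ∃ σ₀ : ℝ, 0 < σ₀ ∧ ∀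 σ : ℝ, 0 < σ → σ < σ₀ → (∀ (N : ℕ) (Φ : Literature.Analysis.FluidPDE.HardSphereFlow (Literature.Analysis.FluidPDE.Torus.geometry (Fin 3)) (Literature.MathematicalPhysics.KineticTheory.hsDiameter σ N) (N + 1)), MeasureTheory.IsProbabilityMeasure (Literature.MathematicalPhysics.KineticTheory.localGibbsLaw σ (fun _ => a) (fun _ => u₀) (fun _ => θ) N Φ)) ∧ ∀ N : ℕ, N₀ ≤ N → ∀ Φ : Literature.Analysis.FluidPDE.HardSphereFlow (Literature.Analysis.FluidPDE.Torus.geometry (Fin 3)) (Literature.MathematicalPhysics.KineticTheory.hsDiameter σ N) (N + 1), (let h : ℝ := s / (σ ^ 2 * Real.sqrt θ) * ((N + 1 : ℕ) : ℝ) ^ (-(1 / 3 : ℝ)); |s * ((∫⁻ z, ENNReal.ofReal ((h⁻¹ * ∫ r in (0 : ℝ)..h, ∑ i, φ (Φ.flow r z i).1 * g ((Real.sqrt θ)⁻¹ • ((Φ.flow r z i).2 - u₀))) ^ 2) ∂(Literature.MathematicalPhysics.KineticTheory.localGibbsLaw σ (fun _ => a) (fun _ => u₀) (fun _ => θ) N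 Φ)).toReal / (((N : ℝ)) + 1)) - 2 * (∫ x, φ x ^ 2) * Literature.Analysis.UnboundedOperators.dirichletFormInv (Literature.Analysis.UnboundedOperators.hardSphereLinearizedOp (E := Literature.MathematicalPhysics.KineticTheory.V3)) g| ≤ η)

/-- **`N₀` CANNOT BE CHOSEN BEFORE THE WINDOW `s`** (it must grow at least linearly with `s`). With `a = θ = 1`, `u₀ = 0`,
`φ ≡ 1`, `g = g_B`, `η = 1` the strengthening yields `s₀, N₀`; by the quadratic Mazur floor the kinetic-window functional per
particle at `N = N₀` is `≥ c := m_B²/(N₀+1) > 0` for EVERY window and EVERY `σ ≤ 1/2`, so the demanded `s·(≥ c) ≤ 2D + 1`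
fails at `s = max(s₀, (2D+2)/c)` (`D = dirichletFormInv L g_B ≥ 0`); quantitatively `N₀ + 1 ≥ s·m_B²/(2D+η)` is forced. The
hidden conserved charge is `P₀P₁` — orthogonality to the LINEAR invariants does not remove it; only `N → ∞` does (`Θ(1/N)`
per particle). [folklore] -/
theorem not_boltzmannGreenKuboN0BeforeS : ¬ BoltzmannGreenKuboN0BeforeS := by
  intro hyp
  set D := dirichletFormInv (hardSphereLinearizedOp (E := V3)) gB with hDdef
  have hD0 : 0 ≤ D := dirichletFormInv_nonneg _ _
  have hm := mB_pos
  obtain ⟨s₀, hs₀, N₀, h2⟩ := hyp 1 1 0 one_pos one_pos (fun _ => 1) gB continuous_const continuous_gB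
    (fun _ => by simp) ⟨1, abs_gB_le⟩ gB_orth 1 one_pos
  set c : ℝ := mB ^ 2 / ((N₀ : ℝ) + 1) with hcdef
  have hcpos : 0 < c := by positivity
  set s : ℝ := max s₀ ((2 * D + 2) / c) with hsdef
  have hs0 : s₀ ≤ s := le_max_left _ _
  have hsc : (2 * D + 2) / c ≤ s := le_max_right _ _
  have hspos : 0 < s := by linarith
  obtain ⟨σ₀, hσ₀, h3⟩ := h2 s hs0
  set σ : ℝ := min (σ₀ / 2) (1 / 4) with hσdef
  have hσpos : 0 < σ := lt_min (by linarith) (by norm_num)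
  have hσlt : σ < σ₀ := lt_of_le_of_lt (min_le_left _ _) (by linarith)
  have hσle : σ ≤ 1 / 4 := min_le_right _ _
  have hσhalf : σ ≤ 1 / 2 := by linarith
  obtain ⟨hprob, h4⟩ := h3 σ hσpos hσlt
  have hεpos : 0 < hsDiameter σ N₀ := hsDiameter_pos hσpos N₀
  have hεlt : hsDiameter σ N₀ < 2⁻¹ := by
    have := hsDiameter_le hσpos.le N₀
    linarith
  obtain ⟨Φ⟩ := HardSphereFlow.nonempty_torus_holds (d := Fin 3) hεpos hεlt (N₀ + 1)
  haveI := hprob N₀ Φ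
  have k := h4 N₀ le_rfl Φ
  set hN : ℝ := s / (σ ^ 2 * Real.sqrt 1) * ((N₀ + 1 : ℕ) : ℝ) ^ (-(1 / 3 : ℝ)) with hhN
  have hh : 0 < hN := by positivity
  dsimp only at k
  simp only [one_mul, Real.sqrt_one, inv_one, one_smul, sub_zero] at k
  have hint1 : ∫ x : T3, (1 : ℝ) ^ 2 = 1 := by simp
  rw [hint1, mul_one] at k
  -- the quadratic floor
  have hfloor : mB ^ 2 ≤
      ∫ z, (hN⁻¹ * ∫ r in (0 : ℝ)..hN, ∑ i, gB ((Φ.flow r z i).2)) ^ 2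
        ∂(localGibbsLaw σ (fun _ => 1) (fun _ => 0) (fun _ => 1) N₀ Φ) := by
    have := quadratic_mazur_floor (N := N₀) hσhalf Φ hh
    simpa only [FB] using this
  have hAm : AEStronglyMeasurable (fun z => (hN⁻¹ * ∫ r in (0 : ℝ)..hN, ∑ i, gB ((Φ.flow r z i).2)) ^ 2)
      (localGibbsLaw σ (fun _ => 1) (fun _ => 0) (fun _ => 1) N₀ Φ) := by
    have h1 : AEStronglyMeasurable (fun z => hN⁻¹ * ∫ r in (0 : ℝ)..hN, ∑ i, gB ((Φ.flow r z i).2))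
        (localGibbsLaw σ (fun _ => 1) (fun _ => 0) (fun _ => 1) N₀ Φ) := by
      have := (integrable_window 1 1 0 Φ measurable_FB (integrable_FB Φ) hh.le).aestronglyMeasurable.const_mul hN⁻¹
      simpa only [FB] using this
    exact h1.pow 2
  have hW : (∫⁻ z, ENNReal.ofReal ((hN⁻¹ * ∫ r in (0 : ℝ)..hN, ∑ i, gB ((Φ.flow r z i).2)) ^ 2)
      ∂(localGibbsLaw σ (fun _ => 1) (fun _ => 0) (fun _ => 1) N₀ Φ)).toReal =
      ∫ z, (hN⁻¹ * ∫ r in (0 : ℝ)..hN, ∑ i, gB ((Φ.flow r z i).2)) ^ 2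
        ∂(localGibbsLaw σ (fun _ => 1) (fun _ => 0) (fun _ => 1) N₀ Φ) := by
    rw [integral_eq_lintegral_of_nonneg_ae (Eventually.of_forall fun z => sq_nonneg _) hAm]
  rw [hW] at k
  have hWge : c ≤ (∫ z, (hN⁻¹ * ∫ r in (0 : ℝ)..hN, ∑ i, gB ((Φ.flow r z i).2)) ^ 2
      ∂(localGibbsLaw σ (fun _ => 1) (fun _ => 0) (fun _ => 1) N₀ Φ)) / ((N₀ : ℝ) + 1) := by
    rw [le_div_iff₀ (by positivity), hcdef, div_mul_cancel₀ _ (by positivity : ((N₀ : ℝ) + 1) ≠ 0)]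
    exact hfloor
  rw [← hDdef, abs_le] at k
  have hmul : s * c ≤ s * ((∫ z, (hN⁻¹ * ∫ r in (0 : ℝ)..hN, ∑ i, gB ((Φ.flow r z i).2)) ^ 2
      ∂(localGibbsLaw σ (fun _ => 1) (fun _ => 0) (fun _ => 1) N₀ Φ)) / ((N₀ : ℝ) + 1)) :=
    mul_le_mul_of_nonneg_left hWge hspos.le
  have hsk : 2 * D + 2 ≤ s * c := by
    have := (div_le_iff₀ hcpos).1 hsc
    linarith
  linarith [k.2, hmul, hsk]

end Summit.AtomisticToContinuum.HydrodynamicLimit.Theorems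

end
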